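import Literature.NumberTheory.Automorphic.UnitaryDualPairDoubledLineFrames
import Literature.NumberTheory.Automorphic.UnitaryGroupDoubledSiegelOrbit
import HarnessLib

/-!
# The rational stabiliser of `V ⊗ W^Δ` in the doubled `W`-member: row-sum glue, the converse «stabilises ⇒ Siegel»,
# rational symplectic preimages, and `ι(1 ⊗ (γ ⊕ 1)) = ι(1 ⊗ γ) ⊕ 1`

Topic `NumberTheory/Automorphic`; namespace `Literature.NumberTheory.Automorphic.UnitaryGroup` (sequel of `UnitaryDualPairDoubledLineFrames`,
`UnitaryGroupDoubledSiegelOrbit`).  KERNEL only: proved theorems, no definition, no named fact.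

* §1 `isSiegelReindex_finSumFinEquiv_iff_rowSum` — on `GL₂` the tree's Siegel predicate `IsSiegelReindex finSumFinEquiv g`
  (★ `UnitaryGroupDoubledSiegelGeneration`) IS the row-sum condition `g₀₀ + g₀₁ = g₁₀ + g₁₁`; `rowSum_eq_inv` — it passes to `g⁻¹`
  (★ `IsSiegelSum.inv`); `rowSum_reindex_fromBlocks_iff` — `diag(γ₁, γ₂)` has it iff `γ₁ = γ₂` (★ `isSiegelSum_blockDiagGL_iff`);
* §2 **`rowSum_eq_of_conj_doublingDelta_apply_zero`** — CONVERSE of the frames file: if the first `P_𝕐`-clause holds for `δ X δ⁻¹`,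
  `X = ι(1 ⊗ w)` read in the `Fin (n + n)` frame (`N ≠ 0`), then `w` is Siegel (`δ⁻¹ 𝕐 = W^Δ`: ★ `doublingDelta_symm_apply_zero`, so `X`
  keeps the diagonal test vector diagonal; then ★ `rowSum_eq_of_adelicPairToSymplectic_rationalInr_diag`) —
  «`(1 × U(W□)(F)) ∩ Stab(V ⊗ W^Δ) ⊆ 1 × P_Δ(F)`» [GelbartPiatetskishapiroRallis1987, Part A §2 p. 9];
* §3 `exists_ratSp_coe_eq_toSp` — every `ι(1 ⊗ w)`, `w` rational, is the base change of a RATIONAL symplectic matrix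
  (★ `toSp_rationalPairToAdelic_mem_range` transported along a Gram identity `adelicGram eD T_V T_{W□} = T'`); `toAdelic_injective`;
* §4 **`coe_toSp_doubled_eq_spReindex_spSum`** — `ι_{eD}(1 ⊗ (γ ⊕ 1)) = ι_e(1 ⊗ γ) ⊕ 1_{𝕎⁻}` as automorphisms of `𝕎□_𝔸 = 𝔸_F^{n+n} × 𝔸_F^{n+n}`
  (the doubled enumeration `eD : (i,0) ↦ inl (e (i,0)), (i,1) ↦ inr (e (i,0))` reads `V ⊗ (W ⊕ W⁻) = (V ⊗ W) ⊕ (V ⊗ W)⁻`;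
  ★ `adelicPairToSymplectic_rationalPairToAdelic_apply`, ★ `spSumEquiv_apply`) [Kudla1994, §1; HarrisKudlaSweet1996, §1 (1.2)].

Consumer: `stub_SW3_orbit` of `Cruxes/H413/Lines/F0_E2SiegelWeilWeilRange.lean` (cell `pub/hodgecm-mathlib`), seat F0P4-p08, 2026-08-31.

## References

* [GelbartPiatetskishapiroRallis1987] S. Gelbart, I. Piatetski-Shapiro, S. Rallis, LNM 1254 (1987), Part A §2 pp. 7–9.
* [Li1992] J.-S. Li, J. reine angew. Math. 428 (1992), p. 181.
* [HarrisKudlaSweet1996] M. Harris, S. S. Kudla, W. J. Sweet, J. Amer. Math. Soc. 9 (1996), §1 (1.2), (1.11).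
* [Kudla1994] S. S. Kudla, Israel J. Math. 87 (1994), §1.
-/

set_option autoImplicit false

noncomputable section

open scoped Kronecker Matrix
open NumberField
open Literature.RepresentationTheory.HeisenbergGroup
open Literature.NumberTheory.Weil1964

namespace Literature.NumberTheory.Automorphic

namespace UnitaryGroup

/-! ## §1 Row sums: the Siegel predicate on `GL₂`, its inverse closure, block-diagonal elements -/

section RowSum

variable {K : Type*} [Field K]

/-- **the tree's Siegel predicate on `GL₂` is the row-sum condition**: `IsSiegelReindex finSumFinEquiv g ↔ g₀₀ + g₀₁ = g₁₀ + g₁₁`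
(`1 × 1` blocks). [cite: HarrisKudlaSweet1996, §1 (1.11)] -/
theorem isSiegelReindex_finSumFinEquiv_iff_rowSum (g : GL (Fin (1 + 1)) K) :
    DoubledUnitary.IsSiegelReindex (finSumFinEquiv : Fin 1 ⊕ Fin 1 ≃ Fin (1 + 1)) g ↔
      (g : Matrix (Fin (1 + 1)) (Fin (1 + 1)) K) 0 0 + (g : Matrix (Fin (1 + 1)) (Fin (1 + 1)) K) 0 1 =
        (g : Matrix (Fin (1 + 1)) (Fin (1 + 1)) K) 1 0 + (g : Matrix (Fin (1 + 1)) (Fin (1 + 1)) K) 1 1 := by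
  unfold DoubledUnitary.IsSiegelReindex
  rw [← Matrix.ext_iff]
  simp only [Unique.forall_iff]
  have h0 : ((finSumFinEquiv : Fin 1 ⊕ Fin 1 ≃ Fin (1 + 1)) (Sum.inl 0) : Fin (1 + 1)) = 0 := rfl
  have h1 : ((finSumFinEquiv : Fin 1 ⊕ Fin 1 ≃ Fin (1 + 1)) (Sum.inr 0) : Fin (1 + 1)) = 1 := rfl
  simp [Matrix.toBlocks₁₁, Matrix.toBlocks₁₂, Matrix.toBlocks₂₁, Matrix.toBlocks₂₂, h0, h1]

/-- the row-sum condition passes to the inverse (`P_Δ(K)` is a group: ★ `IsSiegelSum.inv`). [cite: HarrisKudlaSweet1996, §1 (1.11)] -/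
theorem rowSum_eq_inv (g : GL (Fin (1 + 1)) K)
    (hg : (g : Matrix (Fin (1 + 1)) (Fin (1 + 1)) K) 0 0 + (g : Matrix (Fin (1 + 1)) (Fin (1 + 1)) K) 0 1 =
      (g : Matrix (Fin (1 + 1)) (Fin (1 + 1)) K) 1 0 + (g : Matrix (Fin (1 + 1)) (Fin (1 + 1)) K) 1 1) :
    ((g⁻¹ : GL (Fin (1 + 1)) K) : Matrix (Fin (1 + 1)) (Fin (1 + 1)) K) 0 0 +
        ((g⁻¹ : GL (Fin (1 + 1)) K) : Matrix (Fin (1 + 1)) (Fin (1 + 1)) K) 0 1 =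
      ((g⁻¹ : GL (Fin (1 + 1)) K) : Matrix (Fin (1 + 1)) (Fin (1 + 1)) K) 1 0 +
        ((g⁻¹ : GL (Fin (1 + 1)) K) : Matrix (Fin (1 + 1)) (Fin (1 + 1)) K) 1 1 := by
  set ψ : GL (Fin 1 ⊕ Fin 1) K ≃* GL (Fin (1 + 1)) K :=
    Units.mapEquiv (Matrix.reindexRingEquiv K (finSumFinEquiv : Fin 1 ⊕ Fin 1 ≃ Fin (1 + 1))).toMulEquiv with hψ
  rw [← isSiegelReindex_finSumFinEquiv_iff_rowSum] at hg ⊢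
  have hg' : DoubledUnitary.IsSiegelSum (ψ.symm g) := by
    rw [← DoubledUnitary.isSiegelReindex_mapEquiv_iff (finSumFinEquiv : Fin 1 ⊕ Fin 1 ≃ Fin (1 + 1)), ← hψ,
      ψ.apply_symm_apply]
    exact hg
  have h := (DoubledUnitary.isSiegelReindex_mapEquiv_iff (finSumFinEquiv : Fin 1 ⊕ Fin 1 ≃ Fin (1 + 1)) _).2 hg'.inv
  rwa [← hψ, map_inv, ψ.apply_symm_apply] at h

/-- **block-diagonal elements**: `w = diag(γ₁, γ₂)` (renumbered) has the row-sum property iff `γ₁ = γ₂` — so `(γ, 1)` is Siegel iff `γ = 1`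
(★ `isSiegelReindex_reindexGL_blockDiagGL_iff`). [cite: GelbartPiatetskishapiroRallis1987, Part A §2 p. 7] -/
theorem rowSum_reindex_fromBlocks_iff (γ₁ γ₂ : GL (Fin 1) K) (w : GL (Fin (1 + 1)) K)
    (hw : (w : Matrix (Fin (1 + 1)) (Fin (1 + 1)) K) = Matrix.reindex finSumFinEquiv finSumFinEquiv
      (Matrix.fromBlocks (γ₁ : Matrix (Fin 1) (Fin 1) K) 0 0 (γ₂ : Matrix (Fin 1) (Fin 1) K))) :
    (w : Matrix (Fin (1 + 1)) (Fin (1 + 1)) K) 0 0 + (w : Matrix (Fin (1 + 1)) (Fin (1 + 1)) K) 0 1 =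
        (w : Matrix (Fin (1 + 1)) (Fin (1 + 1)) K) 1 0 + (w : Matrix (Fin (1 + 1)) (Fin (1 + 1)) K) 1 1 ↔ γ₁ = γ₂ := by
  have hw' : w = reindexGL finSumFinEquiv (blockDiagGL (γ₁, γ₂)) := Units.ext hw
  rw [← isSiegelReindex_finSumFinEquiv_iff_rowSum, hw']
  exact DoubledUnitary.isSiegelReindex_reindexGL_blockDiagGL_iff finSumFinEquiv γ₁ γ₂

end RowSum

/-! ## §2 The converse: the `P_𝕐`-clause for `δ X δ⁻¹`, `X = ι(1 ⊗ w)`, forces `w` to be Siegel -/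

section Converse

variable (F E : Type) [Field F] [NumberField F] [Field E] [NumberField E] [Algebra F E] [Algebra.IsQuadraticExtension F E]
  (c : E ≃ₐ[F] E) {δ : E} (hcδ : c δ = -δ) (hδ : δ ≠ 0) {d : F} (hd : δ * δ = algebraMap F E d)
  (N : ℕ) {n : ℕ} (e : Fin N × Fin 1 ≃ Fin n)
  {TV : Matrix (Fin N) (Fin N) F} {TW2 : Matrix (Fin (1 + 1)) (Fin (1 + 1)) F} (hV : TV.IsSymm) (hW2 : TW2.IsSymm)
  (T : Matrix (Fin n) (Fin n) (AdeleRing (𝓞 F) F)) (hT : IsUnit T.det)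

/-- **the `P_𝕐`-clause for `δ X δ⁻¹` ⇒ `w` Siegel** (`N ≠ 0`): if a symplectic automorphism `X` of the doubled space, equal as an automorphism to
`ι(1 ⊗ w) = toSp eD (adelicInr (toAdelic w))` (`eD = (E₁ ; finSumFinEquiv)`, the doubled enumeration of the E-2 child), satisfies
`((δ X δ⁻¹)(0, y)).1 = 0` for all `y` (the first clause of `P_𝕐(𝔸)`), then `w₀₀ + w₀₁ = w₁₀ + w₁₁`.
[cite: GelbartPiatetskishapiroRallis1987, Part A §2 p. 9] [cite: Li1992, p. 181] -/
theorem rowSum_eq_of_conj_doublingDelta_apply_zero (i : Fin N) (w : rational F E c (1 + 1) (TW2.map (algebraMap F E)))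
    (X : symplecticGroup (polar (Weil1964.adelicForm F (Fin (n + n)) (doubledGramFin F T))))
    (hXw : ((X : symplecticGroup (polar (Weil1964.adelicForm F (Fin (n + n)) (doubledGramFin F T)))) :
        ((Fin (n + n) → AdeleRing (𝓞 F) F) × (Fin (n + n) → AdeleRing (𝓞 F) F)) ≃ₗ[AdeleRing (𝓞 F) F]
          ((Fin (n + n) → AdeleRing (𝓞 F) F) × (Fin (n + n) → AdeleRing (𝓞 F) F))) =
      ((GelbartRogawski1991.UnitaryDualPair.toSp F E c N (1 + 1)
          (((Equiv.prodCongr (Equiv.refl (Fin N)) finSumFinEquiv.symm).trans (Equiv.prodSumDistrib (Fin N) (Fin 1) (Fin 1))).trans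
            ((Equiv.sumCongr e e).trans finSumFinEquiv))
          (TV.map (algebraMap F E)) (TW2.map (algebraMap F E)) hcδ hδ hd hV hW2 rfl rfl
          (adelicInr F E c N (1 + 1) (TV.map (algebraMap F E)) (TW2.map (algebraMap F E))
            (toAdelic F E c (1 + 1) (TW2.map (algebraMap F E)) w)) :
          symplecticGroup (polar (Weil1964.adelicForm F (Fin (n + n))
            (GelbartRogawski1991.UnitaryDualPair.adelicGram F
              (((Equiv.prodCongr (Equiv.refl (Fin N)) finSumFinEquiv.symm).trans (Equiv.prodSumDistrib (Fin N) (Fin 1) (Fin 1))).trans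
                ((Equiv.sumCongr e e).trans finSumFinEquiv)) TV TW2)))) :
        ((Fin (n + n) → AdeleRing (𝓞 F) F) × (Fin (n + n) → AdeleRing (𝓞 F) F)) ≃ₗ[AdeleRing (𝓞 F) F]
          ((Fin (n + n) → AdeleRing (𝓞 F) F) × (Fin (n + n) → AdeleRing (𝓞 F) F))))
    (hP : ∀ y : Fin (n + n) → AdeleRing (𝓞 F) F,
      (((spReindex finSumFinEquiv (Matrix.fromBlocks T 0 0 (-T)) (doublingDelta T hT) * X *
          (spReindex finSumFinEquiv (Matrix.fromBlocks T 0 0 (-T)) (doublingDelta T hT))⁻¹ :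
            symplecticGroup (polar (Weil1964.adelicForm F (Fin (n + n)) (doubledGramFin F T)))) :
        ((Fin (n + n) → AdeleRing (𝓞 F) F) × (Fin (n + n) → AdeleRing (𝓞 F) F)) ≃ₗ[AdeleRing (𝓞 F) F]
          ((Fin (n + n) → AdeleRing (𝓞 F) F) × (Fin (n + n) → AdeleRing (𝓞 F) F))) (0, y)).1 = 0) :
    ((w : GL (Fin (1 + 1)) E) : Matrix (Fin (1 + 1)) (Fin (1 + 1)) E) 0 0 +
        ((w : GL (Fin (1 + 1)) E) : Matrix (Fin (1 + 1)) (Fin (1 + 1)) E) 0 1 =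
      ((w : GL (Fin (1 + 1)) E) : Matrix (Fin (1 + 1)) (Fin (1 + 1)) E) 1 0 +
        ((w : GL (Fin (1 + 1)) E) : Matrix (Fin (1 + 1)) (Fin (1 + 1)) E) 1 1 := by
  have hTinv : T *ᵥ (T⁻¹ *ᵥ fun _ : Fin n => (1 : AdeleRing (𝓞 F) F)) = fun _ => 1 := by
    rw [Matrix.mulVec_mulVec, Matrix.mul_nonsing_inv T hT, Matrix.one_mulVec]
  -- `D⁻¹ (0, z)` is a re-enumerated diagonal vector (`δ⁻¹ 𝕐 = W^Δ`)
  have hDsymm : ∀ z : Fin (n + n) → AdeleRing (𝓞 F) F,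
      ((spReindex finSumFinEquiv (Matrix.fromBlocks T 0 0 (-T)) (doublingDelta T hT) : symplecticGroup (polar (Weil1964.adelicForm F (Fin (n + n)) (doubledGramFin F T)))) : ((Fin (n + n) → AdeleRing (𝓞 F) F) × (Fin (n + n) → AdeleRing (𝓞 F) F)) ≃ₗ[AdeleRing (𝓞 F) F] ((Fin (n + n) → AdeleRing (𝓞 F) F) × (Fin (n + n) → AdeleRing (𝓞 F) F))).symm (0, z) =
        reindexW (AdeleRing (𝓞 F) F) (finSumFinEquiv : Fin n ⊕ Fin n ≃ Fin (n + n)) (Sum.elim (T *ᵥ ((z ∘ ⇑(finSumFinEquiv : Fin n ⊕ Fin n ≃ Fin (n + n))) ∘ Sum.inr))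
          (T *ᵥ ((z ∘ ⇑(finSumFinEquiv : Fin n ⊕ Fin n ≃ Fin (n + n))) ∘ Sum.inr)),
          Sum.elim ((z ∘ ⇑(finSumFinEquiv : Fin n ⊕ Fin n ≃ Fin (n + n))) ∘ Sum.inl)
            ((z ∘ ⇑(finSumFinEquiv : Fin n ⊕ Fin n ≃ Fin (n + n))) ∘ Sum.inl)) := fun z => by
    have h1 : ((spReindex finSumFinEquiv (Matrix.fromBlocks T 0 0 (-T)) (doublingDelta T hT) : symplecticGroup (polar (Weil1964.adelicForm F (Fin (n + n)) (doubledGramFin F T)))) : ((Fin (n + n) → AdeleRing (𝓞 F) F) × (Fin (n + n) → AdeleRing (𝓞 F) F)) ≃ₗ[AdeleRing (𝓞 F) F] ((Fin (n + n) → AdeleRing (𝓞 F) F) × (Fin (n + n) → AdeleRing (𝓞 F) F))).symm (0, z) = reindexW (AdeleRing (𝓞 F) F) (finSumFinEquiv : Fin n ⊕ Fin n ≃ Fin (n + n)) (((doublingDelta T hT : symplecticGroup (polar (Matrix.toLinearMap₂' (AdeleRing (𝓞 F) F) (Matrix.fromBlocks T 0 0 (-T))))) : ((Fin n ⊕ Fin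 n → AdeleRing (𝓞 F) F) × (Fin n ⊕ Fin n → AdeleRing (𝓞 F) F)) ≃ₗ[AdeleRing (𝓞 F) F] ((Fin n ⊕ Fin n → AdeleRing (𝓞 F) F) × (Fin n ⊕ Fin n → AdeleRing (𝓞 F) F))).symm ((reindexW (AdeleRing (𝓞 F) F) (finSumFinEquiv : Fin n ⊕ Fin n ≃ Fin (n + n))).symm (0, z))) := rfl
    rw [h1, reindexW_symm_apply]
    change reindexW (AdeleRing (𝓞 F) F) (finSumFinEquiv : Fin n ⊕ Fin n ≃ Fin (n + n)) (((doublingDelta T hT : symplecticGroup (polar (Matrix.toLinearMap₂' (AdeleRing (𝓞 F) F) (Matrix.fromBlocks T 0 0 (-T))))) : ((Fin n ⊕ Fin n → AdeleRing (𝓞 F) F) × (Fin n ⊕ Fin n → AdeleRing (𝓞 F) F)) ≃ₗ[AdeleRing (𝓞 F) F] ((Fin n ⊕ Fin n → AdeleRing (𝓞 F) F) × (Fin n ⊕ Fin n → AdeleRing (𝓞 F) F))).symm (0, z ∘ ⇑(finSumFinEquiv : Fin n ⊕ Fin n ≃ Fin (n + n)))) = _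
    rw [doublingDelta_symm_apply_zero]
  -- the test vector `y := (0, T⁻¹ 1) ∘ finSumFinEquiv⁻¹` has `D⁻¹ (0, y) = R ((1, 1), (0, 0))`
  have hDu : ((spReindex finSumFinEquiv (Matrix.fromBlocks T 0 0 (-T)) (doublingDelta T hT) : symplecticGroup (polar (Weil1964.adelicForm F (Fin (n + n)) (doubledGramFin F T)))) : ((Fin (n + n) → AdeleRing (𝓞 F) F) × (Fin (n + n) → AdeleRing (𝓞 F) F)) ≃ₗ[AdeleRing (𝓞 F) F] ((Fin (n + n) → AdeleRing (𝓞 F) F) × (Fin (n + n) → AdeleRing (𝓞 F) F))).symm (0, ((Sum.elim (0 : Fin n → AdeleRing (𝓞 F) F) (T⁻¹ *ᵥ fun _ => 1)) ∘ ⇑(finSumFinEquiv : Fin n ⊕ Fin n ≃ Fin (n + n)).symm)) = reindexW (AdeleRing (𝓞 F) F) (finSumFinEquiv : Fin n ⊕ Fin n ≃ Fin (n + n)) ((Sum.elim (fun _ => (1 : AdeleRing (𝓞 F) F)) (fun _ => (1 : AdeleRing (𝓞 F) F)), Sum.elim (0 : Fin n → AdeleRing (𝓞 F) F) (0 : Fin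 n → AdeleRing (𝓞 F) F)) : ((Fin n ⊕ Fin n → AdeleRing (𝓞 F) F) × (Fin n ⊕ Fin n → AdeleRing (𝓞 F) F))) := by
    have hy' : ((Sum.elim (0 : Fin n → AdeleRing (𝓞 F) F) (T⁻¹ *ᵥ fun _ => 1)) ∘ ⇑(finSumFinEquiv : Fin n ⊕ Fin n ≃ Fin (n + n)).symm) ∘ ⇑(finSumFinEquiv : Fin n ⊕ Fin n ≃ Fin (n + n)) = Sum.elim (0 : Fin n → AdeleRing (𝓞 F) F) (T⁻¹ *ᵥ fun _ => 1) := by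
      rw [Function.comp_assoc, Equiv.symm_comp_self, Function.comp_id]
    rw [hDsymm, hy', Sum.elim_comp_inr, Sum.elim_comp_inl, hTinv]
  -- `(D X D⁻¹)(0, y) = (0, z)`, so `X (R u₀) = D⁻¹ (0, z)` is a re-enumerated diagonal vector
  obtain ⟨z, hz⟩ : ∃ z : Fin (n + n) → AdeleRing (𝓞 F) F,
      ((spReindex finSumFinEquiv (Matrix.fromBlocks T 0 0 (-T)) (doublingDelta T hT) * X * (spReindex finSumFinEquiv (Matrix.fromBlocks T 0 0 (-T)) (doublingDelta T hT))⁻¹ : symplecticGroup (polar (Weil1964.adelicForm F (Fin (n + n)) (doubledGramFin F T)))) : ((Fin (n + n) → AdeleRing (𝓞 F) F) × (Fin (n + n) → AdeleRing (𝓞 F) F)) ≃ₗ[AdeleRing (𝓞 F) F] ((Fin (n + n) → AdeleRing (𝓞 F) F) × (Fin (n + n) → AdeleRing (𝓞 F) F))) (0, ((Sum.elim (0 : Fin n → AdeleRing (𝓞 F) F) (T⁻¹ *ᵥ fun _ => 1)) ∘ ⇑(finSumFinEquiv : Fin n ⊕ Fin n ≃ Fin (n + n)).symm)) = (0, z) 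:=
    ⟨_, Prod.ext (hP _) rfl⟩
  have hXu : ((X : symplecticGroup (polar (Weil1964.adelicForm F (Fin (n + n)) (doubledGramFin F T)))) : ((Fin (n + n) → AdeleRing (𝓞 F) F) × (Fin (n + n) → AdeleRing (𝓞 F) F)) ≃ₗ[AdeleRing (𝓞 F) F] ((Fin (n + n) → AdeleRing (𝓞 F) F) × (Fin (n + n) → AdeleRing (𝓞 F) F))) (reindexW (AdeleRing (𝓞 F) F) (finSumFinEquiv : Fin n ⊕ Fin n ≃ Fin (n + n)) ((Sum.elim (fun _ => (1 : AdeleRing (𝓞 F) F)) (fun _ => (1 : AdeleRing (𝓞 F) F)), Sum.elim (0 : Fin n → AdeleRing (𝓞 F) F) (0 : Fin n → AdeleRing (𝓞 F) F)) : ((Fin n ⊕ Fin n → AdeleRing (𝓞 F) F) × (Fin n ⊕ Fin n → AdeleRing (𝓞 F) F)))) = ((spReindex finSumFinEquiv (Matrix.fromBlocks T 0 0 (-T)) (doublingDelta T hT) : symplecticGroup (polar (Weil1964.adelicForm F (Fin (n + n)) (doubledGramFin F T)))) : ((Fin (n + n) → AdeleRing (𝓞 F) F) × (Fin (n + n) →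 AdeleRing (𝓞 F) F)) ≃ₗ[AdeleRing (𝓞 F) F] ((Fin (n + n) → AdeleRing (𝓞 F) F) × (Fin (n + n) → AdeleRing (𝓞 F) F))).symm (0, z) := by
    rw [← hDu, LinearEquiv.eq_symm_apply]
    exact hz
  have hdiag : Weil1964.IsDiag ((reindexW (AdeleRing (𝓞 F) F) (finSumFinEquiv : Fin n ⊕ Fin n ≃ Fin (n + n))).symm (((X : symplecticGroup (polar (Weil1964.adelicForm F (Fin (n + n)) (doubledGramFin F T)))) : ((Fin (n + n) → AdeleRing (𝓞 F) F) × (Fin (n + n) → AdeleRing (𝓞 F) F)) ≃ₗ[AdeleRing (𝓞 F) F] ((Fin (n + n) → AdeleRing (𝓞 F) F) × (Fin (n + n) → AdeleRing (𝓞 F) F))) (reindexW (AdeleRing (𝓞 F) F) (finSumFinEquiv : Fin n ⊕ Fin n ≃ Fin (n + n)) ((Sum.elim (fun _ => (1 : AdeleRing (𝓞 F) F)) (fun _ => (1 : AdeleRing (𝓞 F) F)), Sum.elim (0 : Fin n → AdeleRing (𝓞 F) F) (0 : Fin n → AdeleRing (𝓞 F) F)) : ((Fin n ⊕ Fin n →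 AdeleRing (𝓞 F) F) × (Fin n ⊕ Fin n → AdeleRing (𝓞 F) F)))))) := by
    rw [hXu, hDsymm z, LinearEquiv.symm_apply_apply]
    exact isDiag_diag _ _
  -- read `X = ι(1 ⊗ w)` through the frames and apply the converse of the diagonal lemma at the test vector `(1, 0)`
  rw [hXw, GelbartRogawski1991.UnitaryDualPair.toSp_apply, adelicInr_toAdelic, coe_spReindex_apply] at hdiag
  change Weil1964.IsDiag ((reindexW (AdeleRing (𝓞 F) F) (finSumFinEquiv : Fin n ⊕ Fin n ≃ Fin (n + n))).symm (reindexW (AdeleRing (𝓞 F) F) (finSumFinEquiv : Fin n ⊕ Fin n ≃ Fin (n + n)) (reindexW (AdeleRing (𝓞 F) F) (((Equiv.prodCongr (Equiv.refl (Fin N)) finSumFinEquiv.symm).trans (Equiv.prodSumDistrib (Fin N) (Fin 1) (Fin 1))).trans (Equiv.sumCongr e e))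
    (((adelicPairToSymplectic F E c N (1 + 1) hcδ hδ hd hV hW2 rfl rfl
        (rationalPairToAdelic F E c N (1 + 1) (TV.map (algebraMap F E)) (TW2.map (algebraMap F E))
          (rationalInr F E c N (1 + 1) (TV.map (algebraMap F E)) (TW2.map (algebraMap F E)) w)) :
            symplecticGroup (polar (Matrix.toLinearMap₂' (AdeleRing (𝓞 F) F)
              ((TV.map (algebraMap F (AdeleRing (𝓞 F) F))) ⊗ₖ (TW2.map (algebraMap F (AdeleRing (𝓞 F) F))))))) :
          ((Fin N × Fin (1 + 1) → AdeleRing (𝓞 F) F) × (Fin N × Fin (1 + 1) → AdeleRing (𝓞 F) F)) ≃ₗ[AdeleRing (𝓞 F) F] ((Fin N × Fin (1 + 1) → AdeleRing (𝓞 F) F) × (Fin N × Fin (1 + 1) → AdeleRing (𝓞 F) F)))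
        ((reindexW (AdeleRing (𝓞 F) F) (((Equiv.prodCongr (Equiv.refl (Fin N)) finSumFinEquiv.symm).trans (Equiv.prodSumDistrib (Fin N) (Fin 1) (Fin 1))).trans (Equiv.sumCongr e e))).symm ((reindexW (AdeleRing (𝓞 F) F) (finSumFinEquiv : Fin n ⊕ Fin n ≃ Fin (n + n))).symm (reindexW (AdeleRing (𝓞 F) F) (finSumFinEquiv : Fin n ⊕ Fin n ≃ Fin (n + n)) ((Sum.elim (fun _ => (1 : AdeleRing (𝓞 F) F)) (fun _ => (1 : AdeleRing (𝓞 F) F)), Sum.elim (0 : Fin n → AdeleRing (𝓞 F) F) (0 : Fin n → AdeleRing (𝓞 F) F)) : ((Fin n ⊕ Fin n → AdeleRing (𝓞 F) F) × (Fin n ⊕ Fin n → AdeleRing (𝓞 F) F)))))))))) at hdiag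
  rw [LinearEquiv.symm_apply_apply, LinearEquiv.symm_apply_apply,
    isDiag_iff_of_frame e (doubledFrame_apply_zero e) (doubledFrame_apply_one e), reindexW_apply] at hdiag
  simp only [Function.comp_apply, Equiv.symm_apply_apply] at hdiag
  have hu₀' : (reindexW (AdeleRing (𝓞 F) F) (((Equiv.prodCongr (Equiv.refl (Fin N)) finSumFinEquiv.symm).trans (Equiv.prodSumDistrib (Fin N) (Fin 1) (Fin 1))).trans (Equiv.sumCongr e e))).symm ((Sum.elim (fun _ => (1 : AdeleRing (𝓞 F) F)) (fun _ => (1 : AdeleRing (𝓞 F) F)), Sum.elim (0 : Fin n → AdeleRing (𝓞 F) F) (0 : Fin n → AdeleRing (𝓞 F) F)) : ((Fin n ⊕ Fin n → AdeleRing (𝓞 F) F) × (Fin n ⊕ Fin n → AdeleRing (𝓞 F) F))) = ((fun _ => (1 : AdeleRing (𝓞 F) F)), 0) := by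
    rw [reindexW_symm_apply]
    refine Prod.ext (funext fun p => ?_) (funext fun p => ?_)
    · obtain ⟨j, k⟩ := p
      fin_cases k
      · simp
      · simp
    · obtain ⟨j, k⟩ := p
      fin_cases k
      · simp
      · simp
  rw [hu₀'] at hdiag
  exact rowSum_eq_of_adelicPairToSymplectic_rationalInr_diag F E c hcδ hδ hd N hV hW2 rfl rfl w i ⟨hdiag.1 i, hdiag.2 i⟩

end Converse

/-! ## §3 Rational symplectic preimages of `ι(1 ⊗ w)`; injectivity of `toAdelic` -/

section Preimage

variable (F E : Type) [Field F] [NumberField F] [Field E] [NumberField E] [Algebra F E] [Algebra.IsQuadraticExtension F E]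
  (c : E ≃ₐ[F] E) {δ : E} (hcδ : c δ = -δ) (hδ : δ ≠ 0) {d : F} (hd : δ * δ = algebraMap F E d)
  (N M : ℕ) {n : ℕ} (eD : Fin N × Fin M ≃ Fin n)
  {TV : Matrix (Fin N) (Fin N) F} {TW2 : Matrix (Fin M) (Fin M) F} (hV : TV.IsSymm) (hW2 : TW2.IsSymm)
  (hVd : IsUnit TV.det) (hW2d : IsUnit TW2.det)

include hVd hW2d in
/-- **every `ι(1 ⊗ w)`, `w` rational, is the base change of a rational symplectic matrix** — transported along any Gram identity
`adelicGram eD T_V T_{W□} = T'` (for the E-2 child: `T' = doubledGramFin F (adelicGram e T_V T_W)`), as an equality of automorphisms of `𝕎_𝔸`.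
[cite: GelbartPiatetskishapiroRallis1987, Part A §2 pp. 7–9] -/
theorem exists_ratSp_coe_eq_toSp (T' : Matrix (Fin n) (Fin n) (AdeleRing (𝓞 F) F)) (hT' : IsUnit T'.det)
    (hTT : GelbartRogawski1991.UnitaryDualPair.adelicGram F eD TV TW2 = T') (w : rational F E c M (TW2.map (algebraMap F E))) :
    ∃ x : Matrix.symplecticGroup (Fin n) F,
      ((ratSp F T' hT' x : symplecticGroup (polar (Weil1964.adelicForm F (Fin n) T'))) :
          ((Fin n → AdeleRing (𝓞 F) F) × (Fin n → AdeleRing (𝓞 F) F)) ≃ₗ[AdeleRing (𝓞 F) F]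
            ((Fin n → AdeleRing (𝓞 F) F) × (Fin n → AdeleRing (𝓞 F) F))) =
        ((GelbartRogawski1991.UnitaryDualPair.toSp F E c N M eD (TV.map (algebraMap F E)) (TW2.map (algebraMap F E))
            hcδ hδ hd hV hW2 rfl rfl
            (adelicInr F E c N M (TV.map (algebraMap F E)) (TW2.map (algebraMap F E)) (toAdelic F E c M (TW2.map (algebraMap F E)) w)) :
              symplecticGroup (polar (Weil1964.adelicForm F (Fin n) (GelbartRogawski1991.UnitaryDualPair.adelicGram F eD TV TW2)))) :
          ((Fin n → AdeleRing (𝓞 F) F) × (Fin n → AdeleRing (𝓞 F) F)) ≃ₗ[AdeleRing (𝓞 F) F]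
            ((Fin n → AdeleRing (𝓞 F) F) × (Fin n → AdeleRing (𝓞 F) F))) := by
  subst hTT
  obtain ⟨x, hx⟩ := GelbartRogawski1991.UnitaryDualPair.toSp_rationalPairToAdelic_mem_range F E c N M eD
    (TV.map (algebraMap F E)) (TW2.map (algebraMap F E)) hcδ hδ hd hV hW2 hVd hW2d rfl rfl
    (rationalInr F E c N M (TV.map (algebraMap F E)) (TW2.map (algebraMap F E)) w)
  refine ⟨x, ?_⟩
  rw [adelicInr_toAdelic, ← hx]

omit [NumberField F] [Algebra.IsQuadraticExtension F E] in
/-- `toAdelic : U(J)(F) →* U(J)(𝔸_F)` is injective (`E → 𝔸_E` is): `U(J)(F) ≤ U(J)(𝔸_F)`. [cite: GelbartRogawski1991, §3.2 p. 457] -/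
theorem toAdelic_injective (J : Matrix (Fin M) (Fin M) E) : Function.Injective (toAdelic F E c M J) := by
  intro γ γ' h
  have hm := congrArg (fun u : adelic F E c M J => ((u : GL (Fin M) (AdeleRing (𝓞 E) E)) : Matrix (Fin M) (Fin M) (AdeleRing (𝓞 E) E))) h
  refine Subtype.ext (Units.ext (Matrix.ext fun i j => ?_))
  exact AdeleRing.algebraMap_injective (𝓞 E) E (congrFun (congrFun hm i) j)

end Preimage

/-! ## §4 `ι_{eD}(1 ⊗ (γ ⊕ 1)) = ι_e(1 ⊗ γ) ⊕ 1` as automorphisms of `𝕎□_𝔸` -/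

/-- `Σ_{x : Fin (1+1)} f x = f 0 + f 1` (the `Fin (1 + 1)` spelling of `Fin.sum_univ_two`; private plumbing). [folklore] -/
private theorem sum_univ_fin_one_add_one {M : Type*} [AddCommMonoid M] (f : Fin (1 + 1) → M) : ∑ x, f x = f 0 + f 1 :=
  Fin.sum_univ_two f

section SpSum

variable (F E : Type) [Field F] [NumberField F] [Field E] [NumberField E] [Algebra F E] [Algebra.IsQuadraticExtension F E]
  (c : E ≃ₐ[F] E) {δ : E} (hcδ : c δ = -δ) (hδ : δ ≠ 0) {d : F} (hd : δ * δ = algebraMap F E d)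
  (N : ℕ) {n : ℕ} (e : Fin N × Fin 1 ≃ Fin n)
  {TV : Matrix (Fin N) (Fin N) F} {TW : Matrix (Fin 1) (Fin 1) F} {TW2 : Matrix (Fin (1 + 1)) (Fin (1 + 1)) F}
  (hV : TV.IsSymm) (hW : TW.IsSymm) (hW2 : TW2.IsSymm)

/-- **`ι_{eD}(1 ⊗ w) = ι_e(1 ⊗ γ) ⊕ 1_{𝕎⁻}` for `w = (γ ⊕ 1)` renumbered** — in the doubled enumeration `eD` (`(i,0) ↦ inl (e (i,0))`,
`(i,1) ↦ inr (e (i,0))`, then `finSumFinEquiv`) the pair embedding of `1_V ⊗ diag(γ, 1) ∈ U(J_V) × U(T_{W□})` IS the direct sum of the pair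
embedding of `1_V ⊗ γ` on `𝕎 = V ⊗ W` and the identity on `𝕎⁻`, as automorphisms of `𝕎□_𝔸 = 𝔸_F^{n+n} × 𝔸_F^{n+n}` (the forms play no role).
[cite: Kudla1994, §1] [cite: HarrisKudlaSweet1996, §1 (1.2)] -/
theorem coe_toSp_doubled_eq_spReindex_spSum (γ : rational F E c 1 (TW.map (algebraMap F E)))
    (w : rational F E c (1 + 1) (TW2.map (algebraMap F E)))
    (hw : ((w : GL (Fin (1 + 1)) E) : Matrix (Fin (1 + 1)) (Fin (1 + 1)) E) =
      Matrix.reindex finSumFinEquiv finSumFinEquiv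
        (Matrix.fromBlocks ((γ : GL (Fin 1) E) : Matrix (Fin 1) (Fin 1) E) 0 0 (1 : Matrix (Fin 1) (Fin 1) E))) :
    ((GelbartRogawski1991.UnitaryDualPair.toSp F E c N (1 + 1)
          (((Equiv.prodCongr (Equiv.refl (Fin N)) finSumFinEquiv.symm).trans (Equiv.prodSumDistrib (Fin N) (Fin 1) (Fin 1))).trans
            ((Equiv.sumCongr e e).trans finSumFinEquiv))
          (TV.map (algebraMap F E)) (TW2.map (algebraMap F E)) hcδ hδ hd hV hW2 rfl rfl
          (adelicInr F E c N (1 + 1) (TV.map (algebraMap F E)) (TW2.map (algebraMap F E))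
            (toAdelic F E c (1 + 1) (TW2.map (algebraMap F E)) w)) :
          symplecticGroup (polar (Weil1964.adelicForm F (Fin (n + n))
            (GelbartRogawski1991.UnitaryDualPair.adelicGram F
              (((Equiv.prodCongr (Equiv.refl (Fin N)) finSumFinEquiv.symm).trans (Equiv.prodSumDistrib (Fin N) (Fin 1) (Fin 1))).trans
                ((Equiv.sumCongr e e).trans finSumFinEquiv)) TV TW2)))) :
        ((Fin (n + n) → AdeleRing (𝓞 F) F) × (Fin (n + n) → AdeleRing (𝓞 F) F)) ≃ₗ[AdeleRing (𝓞 F) F]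
          ((Fin (n + n) → AdeleRing (𝓞 F) F) × (Fin (n + n) → AdeleRing (𝓞 F) F))) =
      ((spReindex finSumFinEquiv
          (Matrix.fromBlocks (GelbartRogawski1991.UnitaryDualPair.adelicGram F e TV TW) 0 0
            (-GelbartRogawski1991.UnitaryDualPair.adelicGram F e TV TW))
          (spSum (GelbartRogawski1991.UnitaryDualPair.adelicGram F e TV TW) (-GelbartRogawski1991.UnitaryDualPair.adelicGram F e TV TW)
            (GelbartRogawski1991.UnitaryDualPair.toSp F E c N 1 e (TV.map (algebraMap F E)) (TW.map (algebraMap F E)) hcδ hδ hd hV hW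
                rfl rfl
                (adelicInr F E c N 1 (TV.map (algebraMap F E)) (TW.map (algebraMap F E)) (toAdelic F E c 1 (TW.map (algebraMap F E)) γ)),
              1)) :
          symplecticGroup (polar (Matrix.toLinearMap₂' (AdeleRing (𝓞 F) F)
            (Matrix.reindex finSumFinEquiv finSumFinEquiv
              (Matrix.fromBlocks (GelbartRogawski1991.UnitaryDualPair.adelicGram F e TV TW) 0 0
                (-GelbartRogawski1991.UnitaryDualPair.adelicGram F e TV TW)))))) :
        ((Fin (n + n) → AdeleRing (𝓞 F) F) × (Fin (n + n) → AdeleRing (𝓞 F) F)) ≃ₗ[AdeleRing (𝓞 F) F]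
          ((Fin (n + n) → AdeleRing (𝓞 F) F) × (Fin (n + n) → AdeleRing (𝓞 F) F))) := by
  have hq := isQuadraticCoordinates_rat E c hcδ hδ hd
  have hD0 : ∀ i : Fin N, ((((Equiv.prodCongr (Equiv.refl (Fin N)) finSumFinEquiv.symm).trans (Equiv.prodSumDistrib (Fin N) (Fin 1) (Fin 1))).trans ((Equiv.sumCongr e e).trans finSumFinEquiv)) : Fin N × Fin (1 + 1) ≃ Fin (n + n)) (i, 0) = finSumFinEquiv (Sum.inl (e (i, 0))) := fun i => by
    change finSumFinEquiv ((((Equiv.prodCongr (Equiv.refl (Fin N)) finSumFinEquiv.symm).trans (Equiv.prodSumDistrib (Fin N) (Fin 1) (Fin 1))).trans (Equiv.sumCongr e e)) (i, 0)) = _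
    rw [doubledFrame_apply_zero e i]
  have hD1 : ∀ i : Fin N, ((((Equiv.prodCongr (Equiv.refl (Fin N)) finSumFinEquiv.symm).trans (Equiv.prodSumDistrib (Fin N) (Fin 1) (Fin 1))).trans ((Equiv.sumCongr e e).trans finSumFinEquiv)) : Fin N × Fin (1 + 1) ≃ Fin (n + n)) (i, 1) = finSumFinEquiv (Sum.inr (e (i, 0))) := fun i => by
    change finSumFinEquiv ((((Equiv.prodCongr (Equiv.refl (Fin N)) finSumFinEquiv.symm).trans (Equiv.prodSumDistrib (Fin N) (Fin 1) (Fin 1))).trans (Equiv.sumCongr e e)) (i, 1)) = _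
    rw [doubledFrame_apply_one e i]
  -- the real and imaginary parts of `1 ⊗ w` and of `1 ⊗ γ`
  have hcoe : (((rationalInr F E c N (1 + 1) (TV.map (algebraMap F E)) (TW2.map (algebraMap F E)) w : rationalPair F E c N (1 + 1) (TV.map (algebraMap F E)) (TW2.map (algebraMap F E))) : GL (Fin N × Fin (1 + 1)) E) : Matrix (Fin N × Fin (1 + 1)) (Fin N × Fin (1 + 1)) E) = (1 : Matrix (Fin N) (Fin N) E) ⊗ₖ ((w : GL (Fin (1 + 1)) E) : Matrix (Fin (1 + 1)) (Fin (1 + 1)) E) := rfl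
  have hcoe₁ : (((rationalInr F E c N 1 (TV.map (algebraMap F E)) (TW.map (algebraMap F E)) γ : rationalPair F E c N 1 (TV.map (algebraMap F E)) (TW.map (algebraMap F E))) : GL (Fin N × Fin 1) E) : Matrix (Fin N × Fin 1) (Fin N × Fin 1) E) = (1 : Matrix (Fin N) (Fin N) E) ⊗ₖ ((γ : GL (Fin 1) E) : Matrix (Fin 1) (Fin 1) E) := rfl
  have hre : ((((rationalInr F E c N (1 + 1) (TV.map (algebraMap F E)) (TW2.map (algebraMap F E)) w : rationalPair F E c N (1 + 1) (TV.map (algebraMap F E)) (TW2.map (algebraMap F E))) : GL (Fin N × Fin (1 + 1)) E) : Matrix (Fin N × Fin (1 + 1)) (Fin N × Fin (1 + 1)) E).map (QuadraticCoordinates.re (quadraticRatCoords E (not_mem_range_algebraMap_of_apply_eq_neg E c hcδ hδ)).toAddEquiv)).map (algebraMap F (AdeleRing (𝓞 F) F)) = (1 : Matrix (Fin N) (Fin N) (AdeleRing (𝓞 F) F)) ⊗ₖ ((((w : GL (Fin (1 + 1)) E) : Matrix (Fin (1 + 1)) (Fin (1 + 1)) E).map (QuadraticCoordinates.re (quadraticRatCoords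 E (not_mem_range_algebraMap_of_apply_eq_neg E c hcδ hδ)).toAddEquiv)).map (algebraMap F (AdeleRing (𝓞 F) F))) := by
    rw [hcoe, one_kronecker_map, one_kronecker_map]
  have him : ((((rationalInr F E c N (1 + 1) (TV.map (algebraMap F E)) (TW2.map (algebraMap F E)) w : rationalPair F E c N (1 + 1) (TV.map (algebraMap F E)) (TW2.map (algebraMap F E))) : GL (Fin N × Fin (1 + 1)) E) : Matrix (Fin N × Fin (1 + 1)) (Fin N × Fin (1 + 1)) E).map (QuadraticCoordinates.im (quadraticRatCoords E (not_mem_range_algebraMap_of_apply_eq_neg E c hcδ hδ)).toAddEquiv)).map (algebraMap F (AdeleRing (𝓞 F) F)) = (1 : Matrix (Fin N) (Fin N) (AdeleRing (𝓞 F) F)) ⊗ₖ ((((w : GL (Fin (1 + 1)) E) : Matrix (Fin (1 + 1)) (Fin (1 + 1)) E).map (QuadraticCoordinates.im (quadraticRatCoords E (not_mem_range_algebraMap_of_apply_eq_neg E c hcδ hδ)).toAddEquiv)).map (algebraMap F (AdeleRing (𝓞 F) F))) := by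
    rw [hcoe, one_kronecker_map, one_kronecker_map]
  have hre₁ : ((((rationalInr F E c N 1 (TV.map (algebraMap F E)) (TW.map (algebraMap F E)) γ : rationalPair F E c N 1 (TV.map (algebraMap F E)) (TW.map (algebraMap F E))) : GL (Fin N × Fin 1) E) : Matrix (Fin N × Fin 1) (Fin N × Fin 1) E).map (QuadraticCoordinates.re (quadraticRatCoords E (not_mem_range_algebraMap_of_apply_eq_neg E c hcδ hδ)).toAddEquiv)).map (algebraMap F (AdeleRing (𝓞 F) F)) = (1 : Matrix (Fin N) (Fin N) (AdeleRing (𝓞 F) F)) ⊗ₖ ((((γ : GL (Fin 1) E) : Matrix (Fin 1) (Fin 1) E).map (QuadraticCoordinates.re (quadraticRatCoords E (not_mem_range_algebraMap_of_apply_eq_neg E c hcδ hδ)).toAddEquiv)).map (algebraMap F (AdeleRing (𝓞 F) F))) := by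
    rw [hcoe₁, one_kronecker_map, one_kronecker_map]
  have him₁ : ((((rationalInr F E c N 1 (TV.map (algebraMap F E)) (TW.map (algebraMap F E)) γ : rationalPair F E c N 1 (TV.map (algebraMap F E)) (TW.map (algebraMap F E))) : GL (Fin N × Fin 1) E) : Matrix (Fin N × Fin 1) (Fin N × Fin 1) E).map (QuadraticCoordinates.im (quadraticRatCoords E (not_mem_range_algebraMap_of_apply_eq_neg E c hcδ hδ)).toAddEquiv)).map (algebraMap F (AdeleRing (𝓞 F) F)) = (1 : Matrix (Fin N) (Fin N) (AdeleRing (𝓞 F) F)) ⊗ₖ ((((γ : GL (Fin 1) E) : Matrix (Fin 1) (Fin 1) E).map (QuadraticCoordinates.im (quadraticRatCoords E (not_mem_range_algebraMap_of_apply_eq_neg E c hcδ hδ)).toAddEquiv)).map (algebraMap F (AdeleRing (𝓞 F) F))) := by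
    rw [hcoe₁, one_kronecker_map, one_kronecker_map]
  -- the entries of `w = diag(γ, 1)`
  have hs0 : ((finSumFinEquiv : Fin 1 ⊕ Fin 1 ≃ Fin (1 + 1)).symm 0 : Fin 1 ⊕ Fin 1) = Sum.inl 0 := by decide
  have hs1 : ((finSumFinEquiv : Fin 1 ⊕ Fin 1 ≃ Fin (1 + 1)).symm 1 : Fin 1 ⊕ Fin 1) = Sum.inr 0 := by decide
  have hw00 : ((w : GL (Fin (1 + 1)) E) : Matrix (Fin (1 + 1)) (Fin (1 + 1)) E) 0 0 = ((γ : GL (Fin 1) E) : Matrix (Fin 1) (Fin 1) E) 0 0 := by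
    rw [hw, Matrix.reindex_apply, Matrix.submatrix_apply, hs0, Matrix.fromBlocks_apply₁₁]
  have hw01 : ((w : GL (Fin (1 + 1)) E) : Matrix (Fin (1 + 1)) (Fin (1 + 1)) E) 0 1 = 0 := by
    rw [hw, Matrix.reindex_apply, Matrix.submatrix_apply, hs0, hs1, Matrix.fromBlocks_apply₁₂, Matrix.zero_apply]
  have hw10 : ((w : GL (Fin (1 + 1)) E) : Matrix (Fin (1 + 1)) (Fin (1 + 1)) E) 1 0 = 0 := by
    rw [hw, Matrix.reindex_apply, Matrix.submatrix_apply, hs0, hs1, Matrix.fromBlocks_apply₂₁, Matrix.zero_apply]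
  have hw11 : ((w : GL (Fin (1 + 1)) E) : Matrix (Fin (1 + 1)) (Fin (1 + 1)) E) 1 1 = 1 := by
    rw [hw, Matrix.reindex_apply, Matrix.submatrix_apply, hs1, Matrix.fromBlocks_apply₂₂, Matrix.one_apply_eq]
  have hW₁00 : ((((w : GL (Fin (1 + 1)) E) : Matrix (Fin (1 + 1)) (Fin (1 + 1)) E).map (QuadraticCoordinates.re (quadraticRatCoords E (not_mem_range_algebraMap_of_apply_eq_neg E c hcδ hδ)).toAddEquiv)).map (algebraMap F (AdeleRing (𝓞 F) F))) 0 0 = ((((γ : GL (Fin 1) E) : Matrix (Fin 1) (Fin 1) E).map (QuadraticCoordinates.re (quadraticRatCoords E (not_mem_range_algebraMap_of_apply_eq_neg E c hcδ hδ)).toAddEquiv)).map (algebraMap F (AdeleRing (𝓞 F) F))) 0 0 := by simp only [Matrix.map_apply, hw00]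
  have hW₁01 : ((((w : GL (Fin (1 + 1)) E) : Matrix (Fin (1 + 1)) (Fin (1 + 1)) E).map (QuadraticCoordinates.re (quadraticRatCoords E (not_mem_range_algebraMap_of_apply_eq_neg E c hcδ hδ)).toAddEquiv)).map (algebraMap F (AdeleRing (𝓞 F) F))) 0 1 = 0 := by simp only [Matrix.map_apply, hw01, map_zero]
  have hW₁10 : ((((w : GL (Fin (1 + 1)) E) : Matrix (Fin (1 + 1)) (Fin (1 + 1)) E).map (QuadraticCoordinates.re (quadraticRatCoords E (not_mem_range_algebraMap_of_apply_eq_neg E c hcδ hδ)).toAddEquiv)).map (algebraMap F (AdeleRing (𝓞 F) F))) 1 0 = 0 := by simp only [Matrix.map_apply, hw10, map_zero]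
  have hW₁11 : ((((w : GL (Fin (1 + 1)) E) : Matrix (Fin (1 + 1)) (Fin (1 + 1)) E).map (QuadraticCoordinates.re (quadraticRatCoords E (not_mem_range_algebraMap_of_apply_eq_neg E c hcδ hδ)).toAddEquiv)).map (algebraMap F (AdeleRing (𝓞 F) F))) 1 1 = 1 := by simp only [Matrix.map_apply, hw11, hq.re_one, map_one]
  have hW₂00 : ((((w : GL (Fin (1 + 1)) E) : Matrix (Fin (1 + 1)) (Fin (1 + 1)) E).map (QuadraticCoordinates.im (quadraticRatCoords E (not_mem_range_algebraMap_of_apply_eq_neg E c hcδ hδ)).toAddEquiv)).map (algebraMap F (AdeleRing (𝓞 F) F))) 0 0 = ((((γ : GL (Fin 1) E) : Matrix (Fin 1) (Fin 1) E).map (QuadraticCoordinates.im (quadraticRatCoords E (not_mem_range_algebraMap_of_apply_eq_neg E c hcδ hδ)).toAddEquiv)).map (algebraMap F (AdeleRing (𝓞 F) F))) 0 0 := by simp only [Matrix.map_apply, hw00]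
  have hW₂01 : ((((w : GL (Fin (1 + 1)) E) : Matrix (Fin (1 + 1)) (Fin (1 + 1)) E).map (QuadraticCoordinates.im (quadraticRatCoords E (not_mem_range_algebraMap_of_apply_eq_neg E c hcδ hδ)).toAddEquiv)).map (algebraMap F (AdeleRing (𝓞 F) F))) 0 1 = 0 := by simp only [Matrix.map_apply, hw01, map_zero]
  have hW₂10 : ((((w : GL (Fin (1 + 1)) E) : Matrix (Fin (1 + 1)) (Fin (1 + 1)) E).map (QuadraticCoordinates.im (quadraticRatCoords E (not_mem_range_algebraMap_of_apply_eq_neg E c hcδ hδ)).toAddEquiv)).map (algebraMap F (AdeleRing (𝓞 F) F))) 1 0 = 0 := by simp only [Matrix.map_apply, hw10, map_zero]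
  have hW₂11 : ((((w : GL (Fin (1 + 1)) E) : Matrix (Fin (1 + 1)) (Fin (1 + 1)) E).map (QuadraticCoordinates.im (quadraticRatCoords E (not_mem_range_algebraMap_of_apply_eq_neg E c hcδ hδ)).toAddEquiv)).map (algebraMap F (AdeleRing (𝓞 F) F))) 1 1 = 0 := by simp only [Matrix.map_apply, hw11, hq.im_one, map_zero]
  refine LinearEquiv.ext fun v => ?_
  -- both sides read on coordinates
  have hL : ((GelbartRogawski1991.UnitaryDualPair.toSp F E c N (1 + 1) (((Equiv.prodCongr (Equiv.refl (Fin N)) finSumFinEquiv.symm).trans (Equiv.prodSumDistrib (Fin N) (Fin 1) (Fin 1))).trans ((Equiv.sumCongr e e).trans finSumFinEquiv)) (TV.map (algebraMap F E)) (TW2.map (algebraMap F E)) hcδ hδ hd hV hW2 rfl rfl (adelicInr F E c N (1 + 1) (TV.map (algebraMap F E)) (TW2.map (algebraMap F E)) (toAdelic F E c (1 + 1) (TW2.map (algebraMap F E)) w)) : symplecticGroup (polar (Weil1964.adelicForm F (Fin (n + n)) (GelbartRogawski1991.UnitaryDualPair.adelicGram F (((Equiv.prodCongr (Equiv.refl (Fin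 N)) finSumFinEquiv.symm).trans (Equiv.prodSumDistrib (Fin N) (Fin 1) (Fin 1))).trans ((Equiv.sumCongr e e).trans finSumFinEquiv)) TV TW2)))) : ((Fin (n + n) → AdeleRing (𝓞 F) F) × (Fin (n + n) → AdeleRing (𝓞 F) F)) ≃ₗ[AdeleRing (𝓞 F) F] ((Fin (n + n) → AdeleRing (𝓞 F) F) × (Fin (n + n) → AdeleRing (𝓞 F) F))) v =
      reindexW (AdeleRing (𝓞 F) F) ((((Equiv.prodCongr (Equiv.refl (Fin N)) finSumFinEquiv.symm).trans (Equiv.prodSumDistrib (Fin N) (Fin 1) (Fin 1))).trans ((Equiv.sumCongr e e).trans finSumFinEquiv)) : Fin N × Fin (1 + 1) ≃ Fin (n + n))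
        ((1 : Matrix (Fin N) (Fin N) (AdeleRing (𝓞 F) F)) ⊗ₖ ((((w : GL (Fin (1 + 1)) E) : Matrix (Fin (1 + 1)) (Fin (1 + 1)) E).map (QuadraticCoordinates.re (quadraticRatCoords E (not_mem_range_algebraMap_of_apply_eq_neg E c hcδ hδ)).toAddEquiv)).map (algebraMap F (AdeleRing (𝓞 F) F))) *ᵥ (v.1 ∘ ⇑((((Equiv.prodCongr (Equiv.refl (Fin N)) finSumFinEquiv.symm).trans (Equiv.prodSumDistrib (Fin N) (Fin 1) (Fin 1))).trans ((Equiv.sumCongr e e).trans finSumFinEquiv)) : Fin N × Fin (1 + 1) ≃ Fin (n + n))) + algebraMap F (AdeleRing (𝓞 F) F) d • ((1 : Matrix (Fin N) (Fin N) (AdeleRing (𝓞 F) F)) ⊗ₖ ((((w : GL (Fin (1 + 1)) E) : Matrix (Fin (1 + 1)) (Fin (1 + 1)) E).map (QuadraticCoordinates.im (quadraticRatCoords E (not_mem_range_algebraMap_of_apply_eq_neg E c hcδ hδ)).toAddEquiv)).map (algebraMap F (AdeleRing (𝓞 F) F))) *ᵥ (v.2 ∘ ⇑((((Equiv.prodCongr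 (Equiv.refl (Fin N)) finSumFinEquiv.symm).trans (Equiv.prodSumDistrib (Fin N) (Fin 1) (Fin 1))).trans ((Equiv.sumCongr e e).trans finSumFinEquiv)) : Fin N × Fin (1 + 1) ≃ Fin (n + n)))),
          (1 : Matrix (Fin N) (Fin N) (AdeleRing (𝓞 F) F)) ⊗ₖ ((((w : GL (Fin (1 + 1)) E) : Matrix (Fin (1 + 1)) (Fin (1 + 1)) E).map (QuadraticCoordinates.im (quadraticRatCoords E (not_mem_range_algebraMap_of_apply_eq_neg E c hcδ hδ)).toAddEquiv)).map (algebraMap F (AdeleRing (𝓞 F) F))) *ᵥ (v.1 ∘ ⇑((((Equiv.prodCongr (Equiv.refl (Fin N)) finSumFinEquiv.symm).trans (Equiv.prodSumDistrib (Fin N) (Fin 1) (Fin 1))).trans ((Equiv.sumCongr e e).trans finSumFinEquiv)) : Fin N × Fin (1 + 1) ≃ Fin (n + n))) + (1 : Matrix (Fin N) (Fin N) (AdeleRing (𝓞 F) F)) ⊗ₖ ((((w : GL (Fin (1 + 1)) E) : Matrix (Fin (1 + 1)) (Fin (1 + 1)) E).map (QuadraticCoordinates.re (quadraticRatCoords E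 (not_mem_range_algebraMap_of_apply_eq_neg E c hcδ hδ)).toAddEquiv)).map (algebraMap F (AdeleRing (𝓞 F) F))) *ᵥ (v.2 ∘ ⇑((((Equiv.prodCongr (Equiv.refl (Fin N)) finSumFinEquiv.symm).trans (Equiv.prodSumDistrib (Fin N) (Fin 1) (Fin 1))).trans ((Equiv.sumCongr e e).trans finSumFinEquiv)) : Fin N × Fin (1 + 1) ≃ Fin (n + n)))) := by
    rw [GelbartRogawski1991.UnitaryDualPair.toSp_apply, adelicInr_toAdelic, coe_spReindex_apply, reindexW_symm_apply,
      adelicPairToSymplectic_rationalPairToAdelic_apply, hre, him]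
  have hR : ((spReindex finSumFinEquiv (Matrix.fromBlocks (GelbartRogawski1991.UnitaryDualPair.adelicGram F e TV TW) 0 0 (-GelbartRogawski1991.UnitaryDualPair.adelicGram F e TV TW)) (spSum (GelbartRogawski1991.UnitaryDualPair.adelicGram F e TV TW) (-GelbartRogawski1991.UnitaryDualPair.adelicGram F e TV TW) (GelbartRogawski1991.UnitaryDualPair.toSp F E c N 1 e (TV.map (algebraMap F E)) (TW.map (algebraMap F E)) hcδ hδ hd hV hW rfl rfl (adelicInr F E c N 1 (TV.map (algebraMap F E)) (TW.map (algebraMap F E)) (toAdelic F E c 1 (TW.map (algebraMap F E)) γ)), 1)) : symplecticGroup (polar (Matrix.toLinearMap₂' (AdeleRing (𝓞 F) F) (Matrix.reindex finSumFinEquiv finSumFinEquiv (Matrix.fromBlocks (GelbartRogawski1991.UnitaryDualPair.adelicGram F e TV TW) 0 0 (-GelbartRogawski1991.UnitaryDualPair.adelicGram F e TV TW)))))) : ((Fin (n + n) → AdeleRing (𝓞 F) F) × (Fin (n + n) → AdeleRing (𝓞 F) F)) ≃ₗ[AdeleRing (𝓞 F) F] ((Fin (n + n) → AdeleRing (𝓞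 F) F) × (Fin (n + n) → AdeleRing (𝓞 F) F))) v =
      reindexW (AdeleRing (𝓞 F) F) (finSumFinEquiv : Fin n ⊕ Fin n ≃ Fin (n + n))
        (Sum.elim (((1 : Matrix (Fin N) (Fin N) (AdeleRing (𝓞 F) F)) ⊗ₖ ((((γ : GL (Fin 1) E) : Matrix (Fin 1) (Fin 1) E).map (QuadraticCoordinates.re (quadraticRatCoords E (not_mem_range_algebraMap_of_apply_eq_neg E c hcδ hδ)).toAddEquiv)).map (algebraMap F (AdeleRing (𝓞 F) F))) *ᵥ (((v.1 ∘ ⇑(finSumFinEquiv : Fin n ⊕ Fin n ≃ Fin (n + n))) ∘ Sum.inl) ∘ ⇑e) + algebraMap F (AdeleRing (𝓞 F) F) d • ((1 : Matrix (Fin N) (Fin N) (AdeleRing (𝓞 F) F)) ⊗ₖ ((((γ : GL (Fin 1) E) : Matrix (Fin 1) (Fin 1) E).map (QuadraticCoordinates.im (quadraticRatCoords E (not_mem_range_algebraMap_of_apply_eq_neg E c hcδ hδ)).toAddEquiv)).map (algebraMap F (AdeleRing (𝓞 F) F))) *ᵥ (((v.2 ∘ ⇑(finSumFinEquiv : Fin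 n ⊕ Fin n ≃ Fin (n + n))) ∘ Sum.inl) ∘ ⇑e))) ∘ ⇑e.symm)
            ((v.1 ∘ ⇑(finSumFinEquiv : Fin n ⊕ Fin n ≃ Fin (n + n))) ∘ Sum.inr),
          Sum.elim (((1 : Matrix (Fin N) (Fin N) (AdeleRing (𝓞 F) F)) ⊗ₖ ((((γ : GL (Fin 1) E) : Matrix (Fin 1) (Fin 1) E).map (QuadraticCoordinates.im (quadraticRatCoords E (not_mem_range_algebraMap_of_apply_eq_neg E c hcδ hδ)).toAddEquiv)).map (algebraMap F (AdeleRing (𝓞 F) F))) *ᵥ (((v.1 ∘ ⇑(finSumFinEquiv : Fin n ⊕ Fin n ≃ Fin (n + n))) ∘ Sum.inl) ∘ ⇑e) + (1 : Matrix (Fin N) (Fin N) (AdeleRing (𝓞 F) F)) ⊗ₖ ((((γ : GL (Fin 1) E) : Matrix (Fin 1) (Fin 1) E).map (QuadraticCoordinates.re (quadraticRatCoords E (not_mem_range_algebraMap_of_apply_eq_neg E c hcδ hδ)).toAddEquiv)).map (algebraMap F (AdeleRing (𝓞 F) F))) *ᵥ (((v.2 ∘ ⇑(finSumFinEquiv :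 Fin n ⊕ Fin n ≃ Fin (n + n))) ∘ Sum.inl) ∘ ⇑e)) ∘ ⇑e.symm)
            ((v.2 ∘ ⇑(finSumFinEquiv : Fin n ⊕ Fin n ≃ Fin (n + n))) ∘ Sum.inr)) := by
    rw [adelicInr_toAdelic]
    refine (?_ : _ = reindexW (AdeleRing (𝓞 F) F) (finSumFinEquiv : Fin n ⊕ Fin n ≃ Fin (n + n))
        (Sum.elim ((((adelicPairToSymplectic F E c N 1 hcδ hδ hd hV hW rfl rfl (rationalPairToAdelic F E c N 1 (TV.map (algebraMap F E)) (TW.map (algebraMap F E)) (rationalInr F E c N 1 (TV.map (algebraMap F E)) (TW.map (algebraMap F E)) γ)) : symplecticGroup (polar (Matrix.toLinearMap₂' (AdeleRing (𝓞 F) F) ((TV.map (algebraMap F (AdeleRing (𝓞 F) F))) ⊗ₖ (TW.map (algebraMap F (AdeleRing (𝓞 F) F))))))) : ((Fin N × Fin 1 → AdeleRing (𝓞 F) F) × (Fin N × Fin 1 → AdeleRing (𝓞 F) F)) ≃ₗ[AdeleRing (𝓞 F) F] ((Fin N × Fin 1 → AdeleRing (𝓞 F) F) × (Fin N × Fin 1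 → AdeleRing (𝓞 F) F))) ((((v.1 ∘ ⇑(finSumFinEquiv : Fin n ⊕ Fin n ≃ Fin (n + n))) ∘ Sum.inl) ∘ ⇑e), (((v.2 ∘ ⇑(finSumFinEquiv : Fin n ⊕ Fin n ≃ Fin (n + n))) ∘ Sum.inl) ∘ ⇑e))).1 ∘ ⇑e.symm) ((v.1 ∘ ⇑(finSumFinEquiv : Fin n ⊕ Fin n ≃ Fin (n + n))) ∘ Sum.inr),
          Sum.elim ((((adelicPairToSymplectic F E c N 1 hcδ hδ hd hV hW rfl rfl (rationalPairToAdelic F E c N 1 (TV.map (algebraMap F E)) (TW.map (algebraMap F E)) (rationalInr F E c N 1 (TV.map (algebraMap F E)) (TW.map (algebraMap F E)) γ)) : symplecticGroup (polar (Matrix.toLinearMap₂' (AdeleRing (𝓞 F) F) ((TV.map (algebraMap F (AdeleRing (𝓞 F) F))) ⊗ₖ (TW.map (algebraMap F (AdeleRing (𝓞 F) F))))))) : ((Fin N × Fin 1 → AdeleRing (𝓞 F) F) × (Fin N × Fin 1 → AdeleRing (𝓞 F) F)) ≃ₗ[AdeleRing (𝓞 F) F] ((Fin N × Fin 1 → AdeleRing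 (𝓞 F) F) × (Fin N × Fin 1 → AdeleRing (𝓞 F) F))) ((((v.1 ∘ ⇑(finSumFinEquiv : Fin n ⊕ Fin n ≃ Fin (n + n))) ∘ Sum.inl) ∘ ⇑e), (((v.2 ∘ ⇑(finSumFinEquiv : Fin n ⊕ Fin n ≃ Fin (n + n))) ∘ Sum.inl) ∘ ⇑e))).2 ∘ ⇑e.symm) ((v.2 ∘ ⇑(finSumFinEquiv : Fin n ⊕ Fin n ≃ Fin (n + n))) ∘ Sum.inr))).trans ?_
    · rfl
    · rw [adelicPairToSymplectic_rationalPairToAdelic_apply, hre₁, him₁]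
  rw [hL, hR]
  simp only [reindexW_apply]
  refine Prod.ext (funext fun m => ?_) (funext fun m => ?_) <;>
    obtain ⟨⟨i, k⟩, rfl⟩ := ((((Equiv.prodCongr (Equiv.refl (Fin N)) finSumFinEquiv.symm).trans (Equiv.prodSumDistrib (Fin N) (Fin 1) (Fin 1))).trans ((Equiv.sumCongr e e).trans finSumFinEquiv)) : Fin N × Fin (1 + 1) ≃ Fin (n + n)).surjective m <;>
    fin_cases k <;>
    simp only [Fin.zero_eta, Fin.mk_one, Fin.isValue, Function.comp_apply, Equiv.symm_apply_apply] <;>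
    simp only [Function.comp_apply, Equiv.symm_apply_apply, hD0, hD1, Sum.elim_inl, Sum.elim_inr, Pi.add_apply, Pi.smul_apply,
        smul_eq_mul, one_kronecker_mulVec, Fin.sum_univ_one, sum_univ_fin_one_add_one, hW₁00, hW₁01, hW₁10, hW₁11, hW₂00, hW₂01,
        hW₂10, hW₂11, zero_mul, add_zero, one_mul, zero_add, mul_zero, Fin.isValue]

end SpSum

end UnitaryGroup

end Literature.NumberTheory.Automorphic
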